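import Summits.QuantumFields.YangMills.Theorems.BalabanLadderIRcofSchurFejerFiniteCentralKer
import HarnessLib

/-!
# Line `equipartition_seam` (crux `IRcof`, stmt-QuantumFields-26930) — Schur–Fejér core: POINTER (rev 12)

Everything that revisions 1–11 of this workfile contained is LANDED in `Theorems/` (LEAD lane `ym-ir-line-ab-p1` g7 from this
ideator's cuts; critic `ym-ir-crit-3` g4 typereads CLEAN), all in namespace
`Summit.QuantumFields.YangMills.Cruxes.IRcof.EquipartitionSeam.SchurFejer`:

| § | content | landed file | pid |
|---|---|---|---|
| 1–2 | Schur-product ∕ Gram-matrix engine, `schurPow`, trace-evaluation CLM | `BalabanLadderIRcofSchurFejerCore` | p669107 |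
| 3 | Fejér windows `fejerWindow`, nonnegativity, exactness on twist eigen-matrices | `…SchurFejerWindow` | p670440 |
| 4 | `IsTwistEigen`, split weights from windows | `…SchurFejerSplit` | p670962 |
| 5a | Laplace ∕ flat-top estimate | `…SchurFejerLaplace` | p671511 |
| 5b | `IsSplitWindow` (window ⇒ `TwistSplitWeight`) | `…SchurFejerSplitWindow` | p672673 |
| 5c | `splitVanishingAt_of_window` | `…SchurFejerSplitVanishing` | p672985 |
| 6a–b | `IsTwistChar`, twist characters of the centre | `…SchurFejerTwistChar` | p673312 |
| 6c–d | isotypic amplitudes | `…SchurFejerIsotypic` | p673885 |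
| 6e–f | cyclic kernels: `exists_isSplitWindow_of_cyclic`, `splitVanishingAt_of_cyclic_ker` | `…SchurFejerCyclicKer` | p674217 |
| 7a | amplitude characters `ampChar`, `isTwistChar_ampChar` | `…SchurFejerAmpChar` | p674461 |
| 8a–c | joint amplitudes `jointAmp`, coordinates `coord ∕ elemOf ∕ twistOn`, `exists_twistOn_nondegenerate` | `…SchurFejerJointAmp` | p675446 |
| 8d | `generationPi` (AddChar duality on `Π i, ZMod (n i)`) | `…SchurFejerGenerationPi` | p675451 |
| 8e–f | `prodWindowOf`, `exists_isSplitWindow_of_finite_central`, `splitVanishingAt_of_finite_central_ker`, ★★ `splitVanishing_text` | `…SchurFejerFiniteCentralKer` | p675909 |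

CONSEQUENCE.  Stub S2ᵛ `SplitVanishing` of the registered skeleton `Lines/equipartition_seam.lean` is DISCHARGED BY NAME since its
rev 5: `theorem splitVanishing_holds : SplitVanishing := SchurFejer.splitVanishing_text`.  The check below re-asserts, against the
landed module only, that the landed theorem has the statement of S2ᵛ character for character.

HONEST LABEL.  The Yang–Mills mass gap (Clay) is NOT proved; `IRcof` ∕ `IR` 0 ∕ 1; row 47 class PWP (walls S3 ∕ S5ᵛ untouched;
mechanism 0 — a transported positivity argument); nothing continuum ∕ OS ∕ Clay.
-/

set_option autoImplicit false

open Filter Topology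
open Literature.MathematicalPhysics.QuantumFieldTheory
open Summit.QuantumFields.YangMills.Theorems.NonSimplyConnectedLatticeGap

namespace Summit.QuantumFields.YangMills.Cruxes.IRcof.EquipartitionSeam.SchurFejer

/-- Pointer check: the landed `splitVanishing_text` has exactly the statement of stub S2ᵛ `SplitVanishing`
(`Lines/equipartition_seam.lean` l.255–262, verbatim). -/
example :
    ∀ (G : Type) [Group G] [TopologicalSpace G] [IsTopologicalGroup G] [CompactSpace G] [MeasurableSpace G]
      [BorelSpace G], IsCompactSimpleLieGroup G →
    ∀ (H : Type) [Group H] [TopologicalSpace H] [IsTopologicalGroup H] [CompactSpace H] [MeasurableSpace H]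
      [BorelSpace H], IsCompactSimpleLieGroup H → SimplyConnectedSpace H →
    ∀ (π : H →* G), Continuous π → Function.Surjective π → π.ker ≤ Subgroup.center H → (π.ker : Set H).Finite →
      π.ker ≠ ⊥ →
    ∀ (ρH : LatticeRep H) (r : LatticeRep G),
      ∃ c : ℝ → ℝ, Tendsto (fun β => c β * β) atTop atTop ∧
        ∃ β_s : ℝ, ∀ β : ℝ, β_s ≤ β → ∃ w : H → ℝ, TwistSplitWeight π ρH r (c β) β w :=
  splitVanishing_text

end Summit.QuantumFields.YangMills.Cruxes.IRcof.EquipartitionSeam.SchurFejer
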